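import Literature.MathematicalPhysics.QuantumFieldTheory.OSAxiomsFreeFieldGaussianProofs
import Literature.MathematicalPhysics.QuantumFieldTheory.OSAxiomsFreeFieldRPProofs
import Literature.MathematicalPhysics.QuantumFieldTheory.OSAxiomsFreeFieldKernelProofs
import Literature.MathematicalPhysics.QuantumFieldTheory.OSAxiomsFreeFieldErgodicProofs
import HarnessLib

/-!
# Discharged fact: the free field satisfies the OS axioms (`IsFreeField.isOSMeasure`)

`Literature/MathematicalPhysics/QuantumFieldTheory/OSAxioms.lean` (constructive-qft.S07) records
as the named fact

* `Literature.MathematicalPhysics.QuantumLattice.IsFreeField.isOSMeasure` — for every `d ≥ 1`,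
  every `m > 0` and every law `μ` on `𝒮'(ℝ^d)` which is a free field of mass `m`
  (`IsFreeField m μ`: a centred Gaussian Borel probability measure with generating functional
  `S{f} = exp (-½ C_m(f, f))`, `C_m = (-Δ + m²)⁻¹`), `μ` satisfies the Osterwalder–Schrader
  axioms of Glimm–Jaffe §6.1 in the measure form `IsOSMeasure d μ`: it is a probability measure
  with OS0 (analyticity and exponential moments), OS1 (regularity for some `1 ≤ p ≤ 2`, `c`), OS2
  (Euclidean invariance), OS3 (reflection positivity) and OS4 (ergodicity of time translations).

This file proves it,

* `Literature.MathematicalPhysics.QuantumLattice.IsFreeField.isOSMeasure_holds`,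

by assembling the five components proved in the sibling files

* OS0 `IsFreeField.isOS0Analytic` and OS2 `IsFreeField.isOS2Invariant`
  (`OSAxiomsFreeFieldGaussianProofs.lean`: complex Gaussian integral (6.2.2); invariance of
  `C_m` and uniqueness from the generating functional);
* OS1 `IsFreeField.isOS1Regular` with `p = 2`, `c = (2m²)⁻¹`, including the locally integrable
  two-point kernel `K_m(x - y)`, `K_m = ∫₀^∞ e^{-m²t} p_t dt`
  (`OSAxiomsFreeFieldKernelProofs.lean`);
* OS3 `IsFreeField.isOS3ReflectionPositive` (`OSAxiomsFreeFieldRPProofs.lean`: Glimm–Jaffe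
  Thm 6.2.2 via the Schur product theorem, and Prop. 6.2.5);
* OS4 `IsFreeField.isOS4Ergodic` (`OSAxiomsFreeFieldErgodicProofs.lean`: Glimm–Jaffe
  Thm 19.7.1 — clustering of `e^{iω(h)}` by Riemann–Lebesgue, density of their span in `L²(μ)`,
  `L²`-contraction of the time average).

No statement or definition of the tree is changed; no definition is introduced.

## References

* J. Glimm, A. Jaffe, *Quantum Physics: a functional integral point of view*, 2nd ed., Springer
  (1987), §6.1 pp. 89–90 (axioms OS0–OS4), §6.2 (the free field: (6.2.2), Thm 6.2.2, Thm 6.2.4,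
  Prop. 6.2.5), §7.1–7.2 (the free covariance), §19.7 Thm 19.7.1 (ergodicity). [GlimmJaffeQP1987]
* E. Nelson, *The free Markoff field*, J. Funct. Anal. 12 (1973) 211–227. [Nelson1973]
* K. Osterwalder, R. Schrader, *Axioms for Euclidean Green's functions I, II*, Comm. Math. Phys.
  31 (1973) 83–112; 42 (1975) 281–305.
-/

open MeasureTheory

noncomputable section

namespace Literature.MathematicalPhysics.QuantumFieldTheory

open QuantumLattice

variable {d : ℕ} [NeZero d]

/-- Discharge of the named fact
`Literature.MathematicalPhysics.QuantumLattice.IsFreeField.isOSMeasure`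
(**constructive-qft.S07: the free Euclidean field of mass `m > 0` satisfies OS0–OS4**;
Glimm–Jaffe §6.1–6.2, Thm 6.2.2, Thm 6.2.4, Prop. 6.2.5, §19.7; Nelson 1973). The five axioms
are `IsFreeField.isOS0Analytic`, `IsFreeField.isOS1Regular` (with `p = 2`, `c = (2m²)⁻¹`),
`IsFreeField.isOS2Invariant`, `IsFreeField.isOS3ReflectionPositive`, `IsFreeField.isOS4Ergodic`;
a Gaussian measure is a probability measure.
[cite: GlimmJaffeQP1987, §6.1 OS0–OS4; §6.2 Thm 6.2.2, Prop. 6.2.5; §19.7 Thm 19.7.1] -/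
theorem _root_.Literature.MathematicalPhysics.QuantumLattice.IsFreeField.isOSMeasure_holds :
    IsFreeField.isOSMeasure (d := d) := by
  intro m μ h hm
  haveI : ProbabilityTheory.IsGaussian μ := h.1.1
  exact
    { isProbabilityMeasure := inferInstance
      os0 := h.isOS0Analytic
      os1 := ⟨2, 1 / (2 * m ^ 2), h.isOS1Regular hm⟩
      os2 := h.isOS2Invariant
      os3 := h.isOS3ReflectionPositive hm
      os4 := h.isOS4Ergodic hm }

end Literature.MathematicalPhysics.QuantumFieldTheory
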